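import Literature.Probability.Percolation.ArmSeparationInnerFrames
import HarnessLib

/-!
# Sectors of the hexagon and the frames

Topic: Probability / Percolation; family `crit-perc`. A toolkit brick of the discharge of
`Literature.Probability.Percolation.Nolin2008_twoArm_separation` (Nolin 2008, Thm. 11
[arXiv 0711.4948: Thm. 10]; `ArmSeparation.lean`), landing step of the internal extremities
(Nolin 2008, Prop. 12 [arXiv Prop. 11]): the bookkeeping that keeps the corridors of the two
colours apart. The six frames `frameIso i` (`ArmSeparationInnerFrames.lean`) carry the side
`x₀ = m` of `Λ_m` to the six sides; correspondingly the plane splits into six **sectors** (the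
cones spanned by consecutive vertices of the hexagons `|v| = r`), and `frameIso i` carries the
sector of the side `x₀ = m` — `{x₁ ≤ 0 ≤ x₀ + x₁}` — onto the `i`-th one. With a margin `λ`
(distance `≥ λ` from the two bounding rays, `λ < 0` allowed: an overshoot of `|λ|`) the sectors
are pairwise disjoint as soon as the margins add up positively (`disjoint_sectorNear`); this is
how structures attached to different sides are separated, whatever their depths. The frame
coordinates of a point — its **depth coordinate** `dep i v = (frameIso i)⁻¹ v 0` and its
**lateral coordinate** `lat i v = (frameIso i)⁻¹ v 1` — are explicit linear forms.

* `sectorNear i λ`, `mem_sectorNear_iff_of_lt`, `frameIso_mem_sectorNear_iff`;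
* `disjoint_sectorNear` — sectors `i ≠ j` with margins `λ, μ`, `λ + μ > 0`, are disjoint;
* `lat i v`, `dep i v`, `lat_frameIso`, `dep_frameIso`, `lat_eq`, `dep_eq`.

## References

* P. Nolin, *Near-critical percolation in two dimensions*, Electron. J. Probab. 13 (2008), §4.3
  Prop. 12, §4.4 [arXiv 0711.4948: Prop. 11, Thm. 10]. [Nolin2008]
-/

noncomputable section

open Set

namespace Literature.Probability.Percolation

open LatticeModels

/-- **The `i`-th sector with margin `λ`**: the image under `frameIso i` of the cone
`{x₁ ≤ -λ, λ ≤ x₀ + x₁}` of the side `x₀ = m` (between the rays through the vertices `(1, -1)`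
and `(1, 0)`), written out in coordinates. [folklore] -/
def sectorNear (i : ℕ) (lam : ℤ) : Set (Site 2) :=
  match i with
  | 0 => {v | v 1 ≤ -lam ∧ lam ≤ v 0 + v 1}
  | 1 => {v | lam ≤ v 0 ∧ lam ≤ v 1}
  | 2 => {v | v 0 ≤ -lam ∧ lam ≤ v 0 + v 1}
  | 3 => {v | lam ≤ v 1 ∧ v 0 + v 1 ≤ -lam}
  | 4 => {v | v 0 ≤ -lam ∧ v 1 ≤ -lam}
  | 5 => {v | lam ≤ v 0 ∧ v 0 + v 1 ≤ -lam}
  | _ => ∅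

/-- **The lateral coordinate** of `v` in the frame `i`: `((frameIso i)⁻¹ v) 1`, as a linear form. [folklore] -/
def lat (i : ℕ) (v : Site 2) : ℤ :=
  match i with
  | 0 => v 1
  | 1 => -v 0
  | 2 => v 0
  | 3 => -v 1
  | 4 => v 0
  | 5 => -v 0
  | _ => 0

/-- **The depth coordinate** of `v` in the frame `i`: `((frameIso i)⁻¹ v) 0`, as a linear form. [folklore] -/
def dep (i : ℕ) (v : Site 2) : ℤ :=
  match i with
  | 0 => v 0
  | 1 => v 0 + v 1
  | 2 => v 1
  | 3 => -v 0
  | 4 => -(v 0 + v 1)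
  | 5 => -v 1
  | _ => 0

/-- `lat i` is the second frame coordinate (`i < 6`). [folklore] -/
theorem lat_eq {i : ℕ} (hi : i < 6) (v : Site 2) : lat i v = ((frameIso i).symm v) 1 := by
  obtain ⟨a0, a1, b0, b1, c0, c1, d0, d1, e0, e1, f0, f1⟩ := frameIso_symm_apply_formula v
  interval_cases i
  · exact a1.symm
  · exact b1.symm
  · exact c1.symm
  · exact d1.symm
  · exact e1.symm
  · exact f1.symm

/-- `dep i` is the first frame coordinate (`i < 6`). [folklore] -/
theorem dep_eq {i : ℕ} (hi : i < 6) (v : Site 2) : dep i v = ((frameIso i).symm v) 0 := by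
  obtain ⟨a0, a1, b0, b1, c0, c1, d0, d1, e0, e1, f0, f1⟩ := frameIso_symm_apply_formula v
  interval_cases i
  · exact a0.symm
  · exact b0.symm
  · exact c0.symm
  · exact d0.symm
  · exact e0.symm
  · exact f0.symm

/-- The lateral coordinate of a framed point is its second coordinate (`i < 6`). [folklore] -/
theorem lat_frameIso {i : ℕ} (hi : i < 6) (u : Site 2) : lat i (frameIso i u) = u 1 := by
  rw [lat_eq hi, RelIso.symm_apply_apply]

/-- The depth coordinate of a framed point is its first coordinate (`i < 6`). [folklore] -/
theorem dep_frameIso {i : ℕ} (hi : i < 6) (u : Site 2) : dep i (frameIso i u) = u 0 := by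
  rw [dep_eq hi, RelIso.symm_apply_apply]

/-- Membership in a sector, through the frame coordinates (`i < 6`). [folklore] -/
theorem mem_sectorNear_iff_of_lt {i : ℕ} (hi : i < 6) {lam : ℤ} {v : Site 2} :
    v ∈ sectorNear i lam ↔ lat i v ≤ -lam ∧ lam ≤ dep i v + lat i v := by
  interval_cases i <;> simp only [sectorNear, lat, dep, Set.mem_setOf_eq] <;> omega

/-- **The frames carry the sector of the side `x₀ = m` to the `i`-th sector**: `frameIso i u` lies
in `sectorNear i λ` iff `u₁ ≤ -λ` and `λ ≤ u₀ + u₁` (`i < 6`). [folklore] -/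
theorem frameIso_mem_sectorNear_iff {i : ℕ} (hi : i < 6) {lam : ℤ} {u : Site 2} :
    frameIso i u ∈ sectorNear i lam ↔ u 1 ≤ -lam ∧ lam ≤ u 0 + u 1 := by
  rw [mem_sectorNear_iff_of_lt hi, lat_frameIso hi, dep_frameIso hi]

/-- **Distinct sectors are disjoint** when their margins satisfy `λ + μ > 0` (e.g. one margin large,
the other a small overshoot). [folklore] -/
theorem disjoint_sectorNear {i j : ℕ} (hi : i < 6) (hj : j < 6) (hij : i ≠ j) {lam mu : ℤ} (h1 : 0 < lam + mu) :
    Disjoint (sectorNear i lam) (sectorNear j mu) := by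
  rw [Set.disjoint_left]
  intro v hv hv'
  interval_cases i <;> interval_cases j <;>
    simp only [sectorNear, Set.mem_setOf_eq, ne_eq, not_true_eq_false] at hv hv' hij <;> omega

/-- The norm dominates the depth coordinate (`i < 6`). [folklore] -/
theorem dep_le_triNorm {i : ℕ} (hi : i < 6) (v : Site 2) : dep i v ≤ triNorm v := by
  rw [dep_eq hi, ← triNorm_frameIso_symm i hi v]
  exact le_triNorm_iff_lin.2 (Or.inl le_rfl)

/-- In its sector (margin `λ ≥ 0`), a point's norm is its depth coordinate (`i < 6`). [folklore] -/
theorem triNorm_eq_dep_of_mem_sectorNear {i : ℕ} (hi : i < 6) {lam : ℤ} (hl : 0 ≤ lam) {v : Site 2}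
    (hv : v ∈ sectorNear i lam) (hd : 0 ≤ dep i v) : triNorm v = dep i v := by
  rw [mem_sectorNear_iff_of_lt hi] at hv
  rw [dep_eq hi, lat_eq hi] at *
  rw [← triNorm_frameIso_symm i hi v]
  refine le_antisymm (triNorm_le_iff_lin.2 ?_) (le_triNorm_iff_lin.2 (Or.inl le_rfl))
  omega

end Literature.Probability.Percolation
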